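import Summits.Ventures.HodgeRepro2.T5SU11KernelCompositionTwoSidedGlobal
import Summits.Ventures.HodgeRepro2.T5SU11KernelCompositionTransformAbs
import Summits.Ventures.HodgeRepro2.T5SU11ResolventGroundStateWeight
import Summits.Ventures.HodgeRepro2.T5SU11KernelCompositionODE

/-!
# All composed kernels satisfy the two-sided `Ξ`-bound on the whole quadrant:
`|K_λ^{∘(n+2)}(t, s)| ≤ C Ξ(t) Ξ(s)/(λ − 1)^{2n}`

Row 648 gives the bound for `K_λ^{∘2}`. The induction is the row identity `∫ |K_λ(t, r)| Ξ(r) sinh 2r dr = Ξ(t)/(λ − 1)²` (row 619,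
the `Ξ`-transform of `|K_λ|`): if `|K_λ^{∘(n+2)}(r, s)| ≤ C_n Ξ(r) Ξ(s)` then
`|K_λ^{∘(n+3)}(t, s)| ≤ ∫ |K_λ(t, r)| C_n Ξ(r) Ξ(s) sinh 2r dr = C_n Ξ(t) Ξ(s)/(λ − 1)²`.

* `integrableOn_abs_kernel_mul_sph_one_mul_sinh` — `|K_λ(t, r)| Ξ(r) sinh 2r ∈ L¹(0, ∞)`;
* `integral_abs_kernel_mul_sph_one_snd` — `∫ |K_λ(t, r)| Ξ(r) sinh 2r dr = Ξ(t)/(λ − 1)²` (row 619 by symmetry);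
* `kernel_comp_succ_eq_integral` — `K_λ^{∘(n+3)}(t, s) = ∫ K_λ(t, r) K_λ^{∘(n+2)}(r, s) sinh 2r dr`;
* `exists_abs_kernel_comp_le_mul_sph_one_all` — **`∃ C > 0, ∀ n, ∀ t, s > 0, |K_λ^{∘(n+2)}(t, s)| ≤ C/((λ − 1)²)ⁿ · Ξ(t) Ξ(s)`**:
  every composed kernel beyond the first is globally dominated by `Ξ ⊗ Ξ`, with the geometric decay of the Neumann series.

Nothing is claimed about (N).

Blind lane: Mathlib + the HodgeRepro2 prefix only; no sorry; axioms ⊆ {propext, Classical.choice,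
Quot.sound}.
-/

namespace Summit.Ventures.HodgeRepro2.T5SU11KernelCompositionTwoSidedGlobalAll

open Filter Topology MeasureTheory
open Set (Ioi Ioc Icc)
open T5SU11Cartan T5SU11SphericalFunction T5SU11SphericalBounds T5SU11SphericalDecay T5SU11ReductionOfOrder
  T5SU11RadialGreenKernel T5SU11RadialGreenImproper T5SU11RadialGreenImproperDecaySource
  T5SU11ResolventKernelComposition T5SU11ResolventTransformClass T5SU11ResolventNeumann
  T5SU11KernelDifferenceRegularity T5SU11ResolventGroundStateWeight T5SU11KernelCompositionTransformAbs
  T5SU11KernelCompositionTwoSidedGlobal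

section measure

variable [MeasurableSpace Circle] [BorelSpace Circle]

variable {lam : ℝ} (hlam : 1 < lam)

include hlam in
/-- `|K_λ(t, r)| Ξ(r) sinh 2r` is integrable on `(0, ∞)` for `t > 0`. -/
theorem integrableOn_abs_kernel_mul_sph_one_mul_sinh {t : ℝ} (ht : 0 < t) :
    IntegrableOn (fun r => |sphGreenKernel lam t r| * sph 1 (hyp r) * Real.sinh (2 * r)) (Ioi 0) := by
  obtain ⟨hΞ, ⟨Φ, hΦ0, hΦ⟩, hεΞ, CΞ, hCΞ⟩ := sph_one_class hlam
  have hB := integrableOn_sph_mul_mul_sinh_Ioc hΞ hΦ hΦ0 lam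
  have hA := integrableOn_sphDecay_mul_mul_sinh hlam hΞ hΦ hΦ0 hεΞ (fun s hs => hCΞ s hs)
  have h : IntegrableOn (fun r => |greenKernel (fun t => sph lam (hyp t)) (sphDecay lam) t r * sph 1 (hyp r)
      * Real.sinh (2 * r)|) (Ioi 0) := (integrableOn_kernel_mul hB hA ht).abs
  refine IntegrableOn.congr_fun h ?_ measurableSet_Ioi
  intro r hr
  have hr' : (0 : ℝ) < r := hr
  simp only [sphGreenKernel]
  rw [abs_mul, abs_mul, abs_of_pos (sph_hyp_pos 1 r), abs_of_pos (sinh_two_mul_pos hr')]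

include hlam in
/-- **`∫_0^∞ |K_λ(t, r)| Ξ(r) sinh 2r dr = Ξ(t)/(λ − 1)²`** (row 619 by the symmetry of the kernel). -/
theorem integral_abs_kernel_mul_sph_one_snd {t : ℝ} (ht : 0 < t) :
    ∫ r in Ioi 0, |sphGreenKernel lam t r| * sph 1 (hyp r) * Real.sinh (2 * r) = sph 1 (hyp t) / (lam - 1) ^ 2 := by
  rw [← integral_abs_kernel_mul_sph_one' hlam ht]
  apply setIntegral_congr_fun measurableSet_Ioi
  intro r _
  simp only
  rw [sphGreenKernel_symm lam t r]

include hlam in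
/-- **`K_λ^{∘(n+3)}(t, s) = ∫_0^∞ K_λ(t, r) K_λ^{∘(n+2)}(r, s) sinh 2r dr`** (the kernel representation on the class source
`K_λ^{∘(n+2)}(·, s)`, row 503). -/
theorem kernel_comp_succ_eq_integral (n : ℕ) {t s : ℝ} (ht : 0 < t) (hs : 0 < s) :
    ((greenSolI (fun t => sph lam (hyp t)) (sphDecay lam))^[n + 2] (fun u => sphGreenKernel lam u s)) t
      = ∫ r in Ioi 0, sphGreenKernel lam t r
          * ((greenSolI (fun t => sph lam (hyp t)) (sphDecay lam))^[n + 1] (fun u => sphGreenKernel lam u s)) r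
          * Real.sinh (2 * r) := by
  obtain ⟨Ms, hMs0, hMs⟩ := kernel_source_bounded hlam hs
  obtain ⟨Cs, s₀, hCs⟩ := kernel_source_decay hlam hs
  have hks := kernel_source_continuousOn hlam hs
  have hεk : 2 - lam < lam := by linarith
  obtain ⟨hck, ⟨Mk, hMk0, hMk⟩, hdk⟩ := iterate_class (lam₂ := lam) hlam hks hMs hMs0 hεk hCs (n + 1)
  obtain ⟨Kk, Tk, _, _, hKk⟩ := hdk ((1 + lam) / 2) (by rw [min_self]; linarith)
  have hε : 2 - lam < (1 + lam) / 2 := by linarith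
  have hB := integrableOn_sph_mul_mul_sinh_Ioc hck hMk hMk0 lam
  have hA := integrableOn_sphDecay_mul_mul_sinh hlam hck hMk hMk0 hε hKk
  rw [Function.iterate_succ_apply', greenSolI_eq_integral_kernel hB hA ht]
  apply setIntegral_congr_fun measurableSet_Ioi
  intro r _
  simp only [sphGreenKernel]

include hlam in
/-- **ALL COMPOSED KERNELS SATISFY THE TWO-SIDED `Ξ`-BOUND GLOBALLY**: `∃ C > 0, ∀ n, ∀ t, s > 0,
`|K_λ^{∘(n+2)}(t, s)| ≤ C/((λ − 1)²)ⁿ · Ξ(t) Ξ(s)`. -/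
theorem exists_abs_kernel_comp_le_mul_sph_one_all :
    ∃ C : ℝ, 0 < C ∧ ∀ n : ℕ, ∀ t s, 0 < t → 0 < s →
      |((greenSolI (fun t => sph lam (hyp t)) (sphDecay lam))^[n + 1] (fun u => sphGreenKernel lam u s)) t|
        ≤ C / ((lam - 1) ^ 2) ^ n * sph 1 (hyp t) * sph 1 (hyp s) := by
  obtain ⟨C, hC, hC'⟩ := exists_abs_kernel_comp_two_le_mul_sph_one hlam
  refine ⟨C, hC, fun n => ?_⟩
  induction n with
  | zero =>
    intro t s ht hs
    simpa only [pow_zero, div_one] using hC' t s ht hs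
  | succ n ih =>
    intro t s ht hs
    have hμ : 0 < (lam - 1) ^ 2 := by positivity
    rw [kernel_comp_succ_eq_integral hlam n ht hs]
    have hint : IntegrableOn (fun r => sphGreenKernel lam t r
        * ((greenSolI (fun t => sph lam (hyp t)) (sphDecay lam))^[n + 1] (fun u => sphGreenKernel lam u s)) r
        * Real.sinh (2 * r)) (Ioi 0) := by
      obtain ⟨Ms, hMs0, hMs⟩ := kernel_source_bounded hlam hs
      obtain ⟨Cs, s₀, hCs⟩ := kernel_source_decay hlam hs
      have hks := kernel_source_continuousOn hlam hs
      have hεk : 2 - lam < lam := by linarith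
      obtain ⟨hck, ⟨Mk, hMk0, hMk⟩, hdk⟩ := iterate_class (lam₂ := lam) hlam hks hMs hMs0 hεk hCs (n + 1)
      obtain ⟨Kk, Tk, _, _, hKk⟩ := hdk ((1 + lam) / 2) (by rw [min_self]; linarith)
      have hε : 2 - lam < (1 + lam) / 2 := by linarith
      have hB := integrableOn_sph_mul_mul_sinh_Ioc hck hMk hMk0 lam
      have hA := integrableOn_sphDecay_mul_mul_sinh hlam hck hMk hMk0 hε hKk
      exact integrableOn_kernel_mul hB hA ht
    have hmaj := (integrableOn_abs_kernel_mul_sph_one_mul_sinh hlam ht).const_mul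
      (C / ((lam - 1) ^ 2) ^ n * sph 1 (hyp s))
    have hΞs : 0 < sph 1 (hyp s) := sph_hyp_pos 1 s
    calc |∫ r in Ioi 0, sphGreenKernel lam t r
          * ((greenSolI (fun t => sph lam (hyp t)) (sphDecay lam))^[n + 1] (fun u => sphGreenKernel lam u s)) r
          * Real.sinh (2 * r)|
        ≤ ∫ r in Ioi 0, |sphGreenKernel lam t r
          * ((greenSolI (fun t => sph lam (hyp t)) (sphDecay lam))^[n + 1] (fun u => sphGreenKernel lam u s)) r
          * Real.sinh (2 * r)| := abs_integral_le_integral_abs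
      _ ≤ ∫ r in Ioi 0, C / ((lam - 1) ^ 2) ^ n * sph 1 (hyp s)
          * (|sphGreenKernel lam t r| * sph 1 (hyp r) * Real.sinh (2 * r)) := by
          refine setIntegral_mono_on hint.abs hmaj measurableSet_Ioi fun r hr => ?_
          have hr' : (0 : ℝ) < r := hr
          have hih := ih r s hr' hs
          have hsh : 0 ≤ Real.sinh (2 * r) := (sinh_two_mul_pos hr').le
          have hK : 0 ≤ |sphGreenKernel lam t r| := abs_nonneg _
          rw [abs_mul, abs_mul, abs_of_nonneg hsh]
          calc |sphGreenKernel lam t r|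
                * |((greenSolI (fun t => sph lam (hyp t)) (sphDecay lam))^[n + 1] (fun u => sphGreenKernel lam u s)) r|
                * Real.sinh (2 * r)
              ≤ |sphGreenKernel lam t r| * (C / ((lam - 1) ^ 2) ^ n * sph 1 (hyp r) * sph 1 (hyp s)) * Real.sinh (2 * r) :=
                mul_le_mul_of_nonneg_right (mul_le_mul_of_nonneg_left hih hK) hsh
            _ = C / ((lam - 1) ^ 2) ^ n * sph 1 (hyp s)
                * (|sphGreenKernel lam t r| * sph 1 (hyp r) * Real.sinh (2 * r)) := by ring
      _ = C / ((lam - 1) ^ 2) ^ n * sph 1 (hyp s) * (sph 1 (hyp t) / (lam - 1) ^ 2) := by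
          rw [MeasureTheory.integral_const_mul, integral_abs_kernel_mul_sph_one_snd hlam ht]
      _ = C / ((lam - 1) ^ 2) ^ (n + 1) * sph 1 (hyp t) * sph 1 (hyp s) := by
          have hμn : ((lam - 1) ^ 2) ^ n ≠ 0 := pow_ne_zero _ hμ.ne'
          have hμ' : (lam - 1) ^ 2 ≠ 0 := hμ.ne'
          rw [pow_succ, div_mul_eq_div_div, div_div]
          field_simp
          rw [pow_succ, ← mul_assoc, mul_div_assoc, div_self hμ', mul_one, mul_comm]

end measure

end Summit.Ventures.HodgeRepro2.T5SU11KernelCompositionTwoSidedGlobalAll
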